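import Mathlib
import HarnessLib
import Literature.Analysis.Distribution.SchwartzParameterIntegral

/-!
# Route `ThermalWedge`, crux `TwSeededEnsembleEquivalenceR` (stmt-HubbardSuperconductivity-15581):
# Riemann sums over the momentum grid of the two-torus

Support file (`--supports stmt-HubbardSuperconductivity-15581`; no definition; the route file is NOT imported).
For a function `f` continuous on the square `[0, 2π]²`, the averages over the `L × L` momentum grid
`(2πi/L, 2πj/L)` converge to the normalised integral:

  `(1/L²) Σ_{i,j<L} f(2πi/L, 2πj/L) → (4π²)⁻¹ ∫₀^{2π} ∫₀^{2π} f(x, y) dy dx`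

(`twR_abs_gridAverage_sub_integral_le`, ε–L₀ form), by uniform continuity on the compact square and the
one-dimensional estimate `norm_riemannSum_sub_intervalIntegral_le` (tree, `Literature/Analysis/Distribution/
SchwartzParameterIntegral.lean`) applied in `y` at each grid abscissa and then in `x` to `x ↦ ∫₀^{2π} f(x,y) dy`.
This is the input turning the thermodynamic limit of FREE (BdG) torus pressures, which are such grid averages
(`partitionFn_dWaveSourceTorus_zero_re`), into Brillouin-zone integrals. [folklore]
-/

set_option linter.dupNamespace false

noncomputable section

namespace Summit.HubbardSuperconductivity.HubbardSuperconductivity.Theorems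

open Finset Filter MeasureTheory intervalIntegral Set Literature.Analysis.Distribution
open scoped Topology Real

/-- **One-dimensional step inside the square**: for `x ∈ [0,2π]` and `f` with modulus `ω` on `[0,2π]²` at scale
`2π/L` (in the second variable), `|(2π/L) Σ_{j<L} f(x, 2πj/L) - ∫₀^{2π} f(x,y) dy| ≤ 2π ω`. [folklore] -/
theorem twR_abs_inner_riemann_le {f : ℝ → ℝ → ℝ} (hf : Continuous (Function.uncurry f)) {L : ℕ} (hL : 0 < L)
    {ω : ℝ} {x : ℝ}
    (hω : ∀ t ∈ Icc (0 : ℝ) (2 * π), ∀ t' ∈ Icc (0 : ℝ) (2 * π), |t - t'| ≤ (2 * π - 0) / L → ‖f x t - f x t'‖ ≤ ω) :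
    |(2 * π / L) * ∑ j ∈ range L, f x (2 * π * j / L) - ∫ y in (0 : ℝ)..2 * π, f x y| ≤ 2 * π * ω := by
  have hcont : Continuous (f x) := hf.comp (Continuous.prodMk_right x)
  have key := norm_riemannSum_sub_intervalIntegral_le hcont (by positivity : (0 : ℝ) ≤ 2 * π) hL hω
  rw [sub_zero] at key
  have hsum : ∑ i ∈ range L, (2 * π / (L : ℝ)) • f x (0 + i * (2 * π / L)) =
      (2 * π / L) * ∑ j ∈ range L, f x (2 * π * j / L) := by
    rw [Finset.mul_sum]
    refine Finset.sum_congr rfl fun j _ => ?_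
    rw [smul_eq_mul]
    congr 2
    ring
  rw [hsum, Real.norm_eq_abs] at key
  exact key

/-- **Grid averages converge to the Brillouin-zone integral**: for `f` continuous on `ℝ²`, for every `ε > 0`
there is `L₀` with `|(1/L²) Σ_{i,j<L} f(2πi/L, 2πj/L) - (4π²)⁻¹ ∫₀^{2π}∫₀^{2π} f| ≤ ε` for all `L ≥ L₀`. [folklore] -/
theorem twR_abs_gridAverage_sub_integral_le {f : ℝ → ℝ → ℝ} (hf : Continuous (Function.uncurry f)) {ε : ℝ}
    (hε : 0 < ε) :
    ∃ L₀ : ℕ, ∀ L : ℕ, L₀ ≤ L →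
      |(1 / (L : ℝ) ^ 2) * ∑ i ∈ range L, ∑ j ∈ range L, f (2 * π * i / L) (2 * π * j / L) -
        (1 / (4 * π ^ 2)) * ∫ x in (0 : ℝ)..2 * π, ∫ y in (0 : ℝ)..2 * π, f x y| ≤ ε := by
  -- uniform continuity on the compact square
  set K : Set (ℝ × ℝ) := Icc (0 : ℝ) (2 * π) ×ˢ Icc (0 : ℝ) (2 * π) with hK
  have hKc : IsCompact K := isCompact_Icc.prod isCompact_Icc
  have hUC := hKc.uniformContinuousOn_of_continuous hf.continuousOn
  obtain ⟨δ, hδ, hU⟩ := Metric.uniformContinuousOn_iff.1 hUC (ε / 2) (by positivity)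
  obtain ⟨L₀, hL₀⟩ := exists_nat_gt (2 * π / δ)
  refine ⟨L₀, fun L hL => ?_⟩
  have hL₀pos : (0 : ℝ) < L₀ := lt_of_le_of_lt (by positivity) hL₀
  have hLpos : 0 < L := by exact_mod_cast hL₀pos.trans_le (by exact_mod_cast hL : (L₀ : ℝ) ≤ L)
  have hLR : (0 : ℝ) < L := by exact_mod_cast hLpos
  have hmesh : 2 * π / (L : ℝ) < δ := by
    rw [div_lt_iff₀ hLR]
    rw [div_lt_iff₀ hδ] at hL₀
    have : (L₀ : ℝ) ≤ L := by exact_mod_cast hL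
    nlinarith
  -- the modulus `ε/2` at scale `2π/L` on the square, in either variable
  have hmodY : ∀ x ∈ Icc (0 : ℝ) (2 * π), ∀ t ∈ Icc (0 : ℝ) (2 * π), ∀ t' ∈ Icc (0 : ℝ) (2 * π),
      |t - t'| ≤ (2 * π - 0) / L → ‖f x t - f x t'‖ ≤ ε / 2 := by
    intro x hx t ht t' ht' htt
    have h := hU (x, t) ⟨hx, ht⟩ (x, t') ⟨hx, ht'⟩ (by
      rw [Prod.dist_eq, Real.dist_eq, Real.dist_eq, sub_self, abs_zero, max_eq_right (abs_nonneg _)]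
      rw [sub_zero] at htt
      exact htt.trans_lt hmesh)
    rw [Real.dist_eq] at h
    exact h.le
  have hmodX : ∀ x ∈ Icc (0 : ℝ) (2 * π), ∀ x' ∈ Icc (0 : ℝ) (2 * π), |x - x'| ≤ (2 * π - 0) / L →
      ∀ y ∈ Icc (0 : ℝ) (2 * π), |f x y - f x' y| ≤ ε / 2 := by
    intro x hx x' hx' hxx y hy
    have h := hU (x, y) ⟨hx, hy⟩ (x', y) ⟨hx', hy⟩ (by
      rw [Prod.dist_eq, Real.dist_eq, Real.dist_eq, sub_self, abs_zero, max_eq_left (abs_nonneg _)]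
      rw [sub_zero] at hxx
      exact hxx.trans_lt hmesh)
    rw [Real.dist_eq] at h
    exact h.le
  -- grid abscissae lie in the square
  have hgrid : ∀ i ∈ range L, (2 * π * i / L : ℝ) ∈ Icc (0 : ℝ) (2 * π) := by
    intro i hi
    have hi' : (i : ℝ) ≤ L := by exact_mod_cast (Finset.mem_range.1 hi).le
    refine ⟨by positivity, ?_⟩
    rw [div_le_iff₀ hLR]
    nlinarith [Real.pi_pos]
  -- the parametric integral `Φ(x) = ∫₀^{2π} f(x,y) dy`
  set Φ : ℝ → ℝ := fun x => ∫ y in (0 : ℝ)..2 * π, f x y with hΦ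
  have hΦc : Continuous Φ := intervalIntegral.continuous_parametric_intervalIntegral_of_continuous' hf 0 (2 * π)
  have hΦmod : ∀ x ∈ Icc (0 : ℝ) (2 * π), ∀ x' ∈ Icc (0 : ℝ) (2 * π), |x - x'| ≤ (2 * π - 0) / L →
      ‖Φ x - Φ x'‖ ≤ 2 * π * (ε / 2) := by
    intro x hx x' hx' hxx
    have hint : ∀ z, IntervalIntegrable (f z) volume 0 (2 * π) := fun z =>
      (hf.comp (Continuous.prodMk_right z)).intervalIntegrable _ _
    rw [hΦ]
    simp only
    rw [← intervalIntegral.integral_sub (hint x) (hint x')]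
    have h := intervalIntegral.norm_integral_le_of_norm_le_const (a := (0 : ℝ)) (b := 2 * π) (C := ε / 2)
      (f := fun y => f x y - f x' y) fun y hy => ?_
    · rw [sub_zero, abs_of_pos (by positivity : (0 : ℝ) < 2 * π)] at h
      linarith
    · rw [uIoc_of_le (by positivity : (0 : ℝ) ≤ 2 * π)] at hy
      rw [Real.norm_eq_abs]
      exact hmodX x hx x' hx' hxx y ⟨hy.1.le, hy.2⟩
  -- outer Riemann estimate for `Φ`
  have hout := norm_riemannSum_sub_intervalIntegral_le hΦc (by positivity : (0 : ℝ) ≤ 2 * π) hLpos hΦmod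
  have hsumΦ : ∑ i ∈ range L, ((2 * π - 0) / (L : ℝ)) • Φ (0 + i * ((2 * π - 0) / L)) =
      (2 * π / L) * ∑ i ∈ range L, Φ (2 * π * i / L) := by
    rw [Finset.mul_sum]
    refine Finset.sum_congr rfl fun i _ => ?_
    rw [smul_eq_mul, sub_zero]
    congr 2
    ring
  rw [hsumΦ, Real.norm_eq_abs, sub_zero] at hout
  -- inner estimates
  have hin : ∀ i ∈ range L, |(2 * π / L) * ∑ j ∈ range L, f (2 * π * i / L) (2 * π * j / L) - Φ (2 * π * i / L)| ≤
      2 * π * (ε / 2) := fun i hi => twR_abs_inner_riemann_le hf hLpos (hmodY _ (hgrid i hi))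
  -- assemble: `(2π/L)² T - ∬ = (2π/L) Σ_i [inner_i] + [outer]`
  set T := ∑ i ∈ range L, ∑ j ∈ range L, f (2 * π * i / L) (2 * π * j / L) with hT
  set I := ∫ x in (0 : ℝ)..2 * π, ∫ y in (0 : ℝ)..2 * π, f x y with hI
  have hdecomp : (2 * π / L) ^ 2 * T - I =
      (2 * π / L) * ∑ i ∈ range L, ((2 * π / L) * ∑ j ∈ range L, f (2 * π * i / L) (2 * π * j / L) - Φ (2 * π * i / L)) +
        ((2 * π / L) * ∑ i ∈ range L, Φ (2 * π * i / L) - I) := by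
    have e1 : (2 * π / L) * ∑ i ∈ range L, ((2 * π / L) * ∑ j ∈ range L, f (2 * π * i / L) (2 * π * j / L) - Φ (2 * π * i / L)) =
        (2 * π / L) * ∑ i ∈ range L, ((2 * π / L) * ∑ j ∈ range L, f (2 * π * i / L) (2 * π * j / L)) -
          (2 * π / L) * ∑ i ∈ range L, Φ (2 * π * i / L) := by
      rw [Finset.sum_sub_distrib, mul_sub]
    have e2 : (2 * π / L) ^ 2 * T = (2 * π / L) * ∑ i ∈ range L, ((2 * π / L) * ∑ j ∈ range L, f (2 * π * i / L) (2 * π * j / L)) := by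
      rw [hT, pow_two, mul_assoc, Finset.mul_sum]
    rw [e1, e2]
    ring
  have h1 : |(2 * π / L) * ∑ i ∈ range L, ((2 * π / L) * ∑ j ∈ range L, f (2 * π * i / L) (2 * π * j / L) -
      Φ (2 * π * i / L))| ≤ (2 * π / L) * (L * (2 * π * (ε / 2))) := by
    rw [abs_mul, abs_of_pos (by positivity : (0 : ℝ) < 2 * π / L)]
    refine mul_le_mul_of_nonneg_left ((Finset.abs_sum_le_sum_abs _ _).trans ?_) (by positivity)
    calc ∑ i ∈ range L, |(2 * π / L) * ∑ j ∈ range L, f (2 * π * i / L) (2 * π * j / L) - Φ (2 * π * i / L)|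
        ≤ ∑ _i ∈ range L, 2 * π * (ε / 2) := Finset.sum_le_sum hin
      _ = L * (2 * π * (ε / 2)) := by rw [Finset.sum_const, Finset.card_range, nsmul_eq_mul]
  have h2 : |(2 * π / L) * ∑ i ∈ range L, Φ (2 * π * i / L) - I| ≤ 2 * π * (2 * π * (ε / 2)) := by
    exact hout
  have htot : |(2 * π / L) ^ 2 * T - I| ≤ 4 * π ^ 2 * ε := by
    rw [hdecomp]
    refine (abs_add_le _ _).trans ?_
    have e1 : (2 * π / L) * (L * (2 * π * (ε / 2))) = 2 * π ^ 2 * ε := by field_simp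
    nlinarith [h1, h2, e1, Real.pi_pos]
  -- normalise by `4π²`
  have hscale : (1 / (L : ℝ) ^ 2) * T - (1 / (4 * π ^ 2)) * I = ((2 * π / L) ^ 2 * T - I) / (4 * π ^ 2) := by
    field_simp
    ring
  rw [hscale, abs_div, abs_of_pos (by positivity : (0 : ℝ) < 4 * π ^ 2), div_le_iff₀ (by positivity)]
  linarith


/-! ### Summary (registered sub-goal of stmt-HubbardSuperconductivity-15581) -/

/-- **Registered sub-goal `twR_gridAverageLimit`**: grid averages of a continuous function over the `L × L` momentum
grid of the two-torus converge to its normalised Brillouin-zone integral (ε–L₀ form). [folklore] -/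
theorem twR_gridAverageLimit : ∀ (f : ℝ → ℝ → ℝ), Continuous (Function.uncurry f) → ∀ ε : ℝ, 0 < ε → ∃ L₀ : ℕ, ∀ L : ℕ, L₀ ≤ L → |(1 / (L : ℝ) ^ 2) * ∑ i ∈ Finset.range L, ∑ j ∈ Finset.range L, f (2 * Real.pi * i / L) (2 * Real.pi * j / L) - (1 / (4 * Real.pi ^ 2)) * ∫ x in (0 : ℝ)..2 * Real.pi, ∫ y in (0 : ℝ)..2 * Real.pi, f x y| ≤ ε :=
  fun _ hf _ hε => twR_abs_gridAverage_sub_integral_le hf hε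

end Summit.HubbardSuperconductivity.HubbardSuperconductivity.Theorems

end
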